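import Mathlib.Analysis.SpecialFunctions.Log.Summable
import Mathlib.Analysis.SpecificLimits.Normed
import Mathlib.LinearAlgebra.Matrix.Charpoly.Coeff
import Mathlib.LinearAlgebra.Matrix.SchurComplement
import Mathlib.Topology.Instances.Matrix
import Mathlib.Analysis.Normed.Group.Tannery
import Literature.Analysis.Toeplitz.InfiniteMatrix
import HarnessLib

/-!
# Von Koch determinants of corner-dominated kernels

Topic `Analysis/Toeplitz`, namespace `Literature.Analysis.Toeplitz`. For an infinite matrix
`K : ℕ × ℕ → ℂ` with the corner bound `|K i j| ≤ C ρ^{i+j}`, `0 ≤ ρ < 1` (`IsCorner ρ C K`,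
`InfiniteMatrix.lean`), the determinant of `1 + K` is defined by von Koch's absolutely convergent
series of principal minors,

  `det (1 + K) = ∑_{S ⊂ ℕ finite} det (K i j)_{i,j ∈ S}`     (`detOnePlus K`),

(H. von Koch, Acta Math. 16 (1892) 217–295; for finite matrices this is the expansion of
`det (1 + K)` in principal minors, Mathlib's `Matrix.coeff_det_one_add_X_smul_eq_sum_minors`). The
corner bound makes the kernel "super trace class": by the Leibniz expansion a principal minor on
`S` is at most `|S|! C^{|S|} ρ^{2 Σ S}`, and `Σ S ≥ |S|(|S|-1)/2`, so the Gaussian factor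
`ρ^{|S|(|S|-1)/2}` beats `|S|!` and the series converges absolutely with the summable majorant
`B(ρ, C) ρ^{Σ S} = B ∏_{i ∈ S} ρ^i` (no Hadamard inequality is needed). We prove:

* `norm_pminor_le`, `summable_norm_pminor` — absolute convergence;
* `det_one_add_finSection` — the finite sections `det (1 + P_n K P_n)` are the partial sums over
  `S ⊆ {0,…,n-1}`, and `norm_detOnePlus_sub_det_finSection_le` — they converge to `detOnePlus K`
  **uniformly** over all kernels with the same corner bound (`kochTail ρ n → 0`);
* `tendsto_detOnePlus` — dominated convergence: entrywise convergence with a uniform corner bound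
  implies convergence of the determinants;
* `norm_detOnePlus_sub_one_sub_ctrace_le` — `det (1 + K) = 1 + tr K + O(C²)`;
* `detOnePlus_add_mul` — **multiplicativity** `det ((1+K)(1+L)) = det (1+K) det (1+L)`;
* `detOnePlus_imul_comm` — **Sylvester's identity** `det (1 + A K) = det (1 + K A)` for a corner
  kernel `K` and a row- and column-dominated `A` (e.g. a Toeplitz matrix with symbol in a weighted
  Wiener algebra), through Mathlib's finite `Matrix.det_one_add_mul_comm` and the two limits
  `A P_M K`, `K P_N A`.

These are exactly the "abstract theory" steps of the Basor–Helton/Widom proof of the strong Szegő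
limit theorem as summarised in Deift–Its–Krasovsky 2013, §3 (`StrongSzegoGeometric.lean`).

## References

* H. von Koch, Acta Math. 16 (1892) 217–295.
* P. Deift, A. Its, I. Krasovsky, Comm. Pure Appl. Math. 66 (2013) 1360–1438, §3.
-/

noncomputable section

open Finset Filter Matrix
open scoped _root_.Topology BigOperators

namespace Literature.Analysis.Toeplitz

/-! ### Principal minors and the von Koch series -/

/-- The **principal minor** of an infinite matrix on a finite set `S ⊂ ℕ`,
`det (K i j)_{i, j ∈ S}`. [folklore] -/
def pminor (K : Matrix ℕ ℕ ℂ) (S : Finset ℕ) : ℂ :=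
  (K.submatrix (Subtype.val : S → ℕ) (Subtype.val : S → ℕ)).det

/-- The empty minor is `1`. [folklore] -/
@[simp] theorem pminor_empty (K : Matrix ℕ ℕ ℂ) : pminor K ∅ = 1 := by
  rw [pminor]
  haveI : IsEmpty ((∅ : Finset ℕ) : Type) := ⟨fun x => Finset.notMem_empty _ x.2⟩
  exact Matrix.det_isEmpty

/-- A `1 × 1` minor is the diagonal entry. [folklore] -/
@[simp] theorem pminor_singleton (K : Matrix ℕ ℕ ℂ) (i : ℕ) : pminor K {i} = K i i := by
  rw [pminor]
  haveI : Subsingleton (({i} : Finset ℕ) : Type) :=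
    ⟨fun a b => Subtype.ext ((Finset.mem_singleton.1 a.2).trans (Finset.mem_singleton.1 b.2).symm)⟩
  rw [Matrix.det_eq_elem_of_subsingleton _ ⟨i, Finset.mem_singleton_self i⟩]
  rfl

/-- **Von Koch's determinant** of `1 + K`: the sum over all finite `S ⊂ ℕ` of the principal minors
of `K` on `S` (H. von Koch, Acta Math. 16 (1892); the infinite version of the expansion of
`det (1 + K)` in principal minors). A topological sum; for corner-dominated `K` it converges
absolutely (`summable_norm_pminor`) and is the limit of the finite-section determinants
`det (1 + P_n K P_n)` (`tendsto_det_finSection`). [folklore] -/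
def detOnePlus (K : Matrix ℕ ℕ ℂ) : ℂ := ∑' S : Finset ℕ, pminor K S

/-- The **trace** `∑ i, K i i` of an infinite matrix (a topological sum). [folklore] -/
def ctrace (K : Matrix ℕ ℕ ℂ) : ℂ := ∑' i, K i i

/-- The von Koch weight `ρ^{Σ S}` of a finite set. [folklore] -/
def kochWeight (ρ : ℝ) (S : Finset ℕ) : ℝ := ρ ^ (∑ i ∈ S, i)

/-- `ρ^{Σ S} = ∏_{i ∈ S} ρ^i`. [folklore] -/
theorem kochWeight_eq_prod (ρ : ℝ) (S : Finset ℕ) : kochWeight ρ S = ∏ i ∈ S, ρ ^ i :=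
  (prod_pow_eq_pow_sum S id ρ).symm

/-- The von Koch weights are nonnegative for `ρ ≥ 0`. [folklore] -/
theorem kochWeight_nonneg {ρ : ℝ} (hρ : 0 ≤ ρ) (S : Finset ℕ) : 0 ≤ kochWeight ρ S :=
  pow_nonneg hρ _

/-- **The von Koch weights are summable over all finite subsets of `ℕ`** (`0 ≤ ρ < 1`):
`∑_S ∏_{i∈S} ρ^i = ∏_i (1 + ρ^i) < ∞`. [folklore] -/
theorem summable_kochWeight {ρ : ℝ} (hρ : 0 ≤ ρ) (hρ1 : ρ < 1) :
    Summable (kochWeight ρ) := by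
  have h := summable_finsetProd_of_summable_nonneg (fun i => pow_nonneg hρ i)
    (summable_geometric_of_lt_one hρ hρ1)
  refine h.congr fun S => ?_
  exact (kochWeight_eq_prod ρ S).symm

/-! ### The Leibniz bound for a principal minor -/

/-- **Leibniz bound with product domination**: if `|A i j| ≤ r i c j` then
`|det A| ≤ n! (∏ r)(∏ c)`. [folklore] -/
theorem norm_det_le_of_le_mul {n : Type*} [Fintype n] [DecidableEq n] (A : Matrix n n ℂ)
    {r c : n → ℝ} (h : ∀ i j, ‖A i j‖ ≤ r i * c j) :
    ‖A.det‖ ≤ (Fintype.card n).factorial * ((∏ i, r i) * ∏ j, c j) := by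
  rw [Matrix.det_apply']
  have hterm : ∀ σ : Equiv.Perm n,
      ‖(Equiv.Perm.sign σ : ℂ) * ∏ i, A (σ i) i‖ ≤ (∏ i, r i) * ∏ j, c j := by
    intro σ
    have hsign : ‖(Equiv.Perm.sign σ : ℂ)‖ = 1 := by
      rcases Int.units_eq_one_or (Equiv.Perm.sign σ) with hs | hs <;> simp [hs]
    rw [norm_mul, hsign, one_mul]
    calc ‖∏ i, A (σ i) i‖ = ∏ i, ‖A (σ i) i‖ := norm_prod _ _
      _ ≤ ∏ i, r (σ i) * c i :=
          prod_le_prod (fun i _ => norm_nonneg _) (fun i _ => h (σ i) i)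
      _ = (∏ i, r (σ i)) * ∏ j, c j := prod_mul_distrib
      _ = (∏ i, r i) * ∏ j, c j := by rw [Equiv.prod_comp σ r]
  calc ‖∑ σ : Equiv.Perm n, (Equiv.Perm.sign σ : ℂ) * ∏ i, A (σ i) i‖
      ≤ ∑ σ : Equiv.Perm n, ‖(Equiv.Perm.sign σ : ℂ) * ∏ i, A (σ i) i‖ := norm_sum_le _ _
    _ ≤ ∑ _σ : Equiv.Perm n, (∏ i, r i) * ∏ j, c j := sum_le_sum fun σ _ => hterm σ
    _ = (Fintype.card n).factorial * ((∏ i, r i) * ∏ j, c j) := by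
        rw [sum_const, card_univ, Fintype.card_perm, nsmul_eq_mul]

/-- **`Σ S ≥ |S| (|S| - 1) / 2`** for a finite set of naturals (its elements, sorted, dominate
`0, 1, …, |S|-1`). [folklore] -/
theorem choose_two_le_sum (S : Finset ℕ) : S.card.choose 2 ≤ ∑ i ∈ S, i := by
  induction S using Finset.induction_on_max with
  | empty => simp
  | insert a s ha ih =>
    have has : a ∉ s := fun h => lt_irrefl a (ha a h)
    have hcard : s.card ≤ a := by
      have hsub : s ⊆ range a := fun x hx => mem_range.2 (ha x hx)
      simpa using card_le_card hsub
    have key : (s.card + 1).choose 2 = s.card + s.card.choose 2 := by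
      rw [Nat.choose_succ_succ', Nat.choose_one_right]
    rw [card_insert_of_notMem has, sum_insert has, key]
    omega

/-- **The corner bound for a principal minor**: if `|K i j| ≤ C ρ^{i+j}` then
`|det K_S| ≤ |S|! C^{|S|} ρ^{|S|(|S|-1)/2} ρ^{Σ S}` (Leibniz with the row factors `C ρ^i` and column
factors `ρ^j`, then `ρ^{Σ S} ≤ ρ^{|S|(|S|-1)/2}` on one of the two factors `ρ^{Σ S}`). [folklore] -/
theorem norm_pminor_le {ρ C : ℝ} {K : Matrix ℕ ℕ ℂ} (hK : IsCorner ρ C K) (hρ : 0 ≤ ρ)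
    (hρ1 : ρ ≤ 1) (S : Finset ℕ) :
    ‖pminor K S‖ ≤ S.card.factorial * C ^ S.card * ρ ^ (S.card.choose 2) * kochWeight ρ S := by
  have h := norm_det_le_of_le_mul (K.submatrix (Subtype.val : S → ℕ) (Subtype.val : S → ℕ))
    (r := fun i : S => C * ρ ^ (i : ℕ)) (c := fun j : S => ρ ^ (j : ℕ))
    (fun i j => by simpa [pow_add, mul_assoc] using hK i j)
  rw [pminor]
  refine h.trans ?_
  rw [Fintype.card_coe, prod_coe_sort S (fun i => C * ρ ^ i), prod_coe_sort S (fun j => ρ ^ j),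
    prod_mul_distrib, prod_const, prod_pow_eq_pow_sum]
  have hw : ρ ^ (∑ i ∈ S, i) ≤ ρ ^ (S.card.choose 2) :=
    pow_le_pow_of_le_one hρ hρ1 (choose_two_le_sum S)
  have hfac : (0 : ℝ) ≤ S.card.factorial * C ^ S.card := mul_nonneg (Nat.cast_nonneg _)
    (pow_nonneg hK.nonneg _)
  calc (S.card.factorial : ℝ) * (C ^ S.card * ρ ^ (∑ i ∈ S, i) * ρ ^ (∑ i ∈ S, i))
      = S.card.factorial * C ^ S.card * ρ ^ (∑ i ∈ S, i) * kochWeight ρ S := by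
        rw [kochWeight]; ring
    _ ≤ S.card.factorial * C ^ S.card * ρ ^ (S.card.choose 2) * kochWeight ρ S :=
        mul_le_mul_of_nonneg_right (mul_le_mul_of_nonneg_left hw hfac) (kochWeight_nonneg hρ S)

/-- **`m! C^m ρ^{m(m-1)/2}` is bounded** (`0 ≤ ρ < 1`): the ratio of consecutive terms,
`(m+1) C ρ^m`, tends to `0`. [folklore] -/
theorem exists_bound_factorial_mul_pow (C ρ : ℝ) (hC : 0 ≤ C) (hρ : 0 ≤ ρ) (hρ1 : ρ < 1) :
    ∃ B : ℝ, 0 ≤ B ∧ ∀ m : ℕ, (m.factorial : ℝ) * C ^ m * ρ ^ (m.choose 2) ≤ B := by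
  set u : ℕ → ℝ := fun m => (m.factorial : ℝ) * C ^ m * ρ ^ (m.choose 2) with hu
  have hu0 : ∀ m, 0 ≤ u m := fun m =>
    mul_nonneg (mul_nonneg (Nat.cast_nonneg _) (pow_nonneg hC _)) (pow_nonneg hρ _)
  have hrec : ∀ m, u (m + 1) = u m * ((m + 1 : ℝ) * C * ρ ^ m) := by
    intro m
    simp only [hu, Nat.factorial_succ, Nat.cast_mul, Nat.cast_succ, pow_succ, Nat.choose_succ_succ',
      Nat.choose_one_right, pow_add]
    ring
  -- the ratio tends to zero
  have hratio : Tendsto (fun m : ℕ => ((m : ℝ) + 1) * C * ρ ^ m) atTop (𝓝 0) := by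
    have h1 := tendsto_self_mul_const_pow_of_lt_one hρ hρ1
    have h2 := tendsto_pow_atTop_nhds_zero_of_lt_one hρ hρ1
    have h3 := ((h1.add h2).mul_const C)
    rw [zero_add, zero_mul] at h3
    refine h3.congr fun m => ?_
    ring
  obtain ⟨N, hN⟩ := (hratio.eventually (Iic_mem_nhds one_pos)).exists_forall_of_atTop
  -- `u` is nonincreasing from `N` on
  have hanti : ∀ m, N ≤ m → u m ≤ u N := by
    intro m hm
    induction m, hm using Nat.le_induction with
    | base => exact le_rfl
    | succ k hk ih =>
      rw [hrec k]
      exact (mul_le_of_le_one_right (hu0 k) (hN k hk)).trans ih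
  refine ⟨∑ m ∈ range (N + 1), u m, sum_nonneg fun m _ => hu0 m, fun m => ?_⟩
  rcases le_or_gt m N with hm | hm
  · exact single_le_sum (fun k _ => hu0 k) (mem_range.2 (Nat.lt_succ_of_le hm))
  · exact (hanti m hm.le).trans
      (single_le_sum (fun k _ => hu0 k) (mem_range.2 (Nat.lt_succ_self N)))

/-- **Von Koch's constant** `B(ρ, C) ≥ sup_m m! C^m ρ^{m(m-1)/2}` (a bound, chosen once and for all;
`0` outside the range `0 ≤ C`, `0 ≤ ρ < 1`). [folklore] -/
def kochConst (ρ C : ℝ) : ℝ :=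
  if h : 0 ≤ C ∧ 0 ≤ ρ ∧ ρ < 1 then
    Classical.choose (exists_bound_factorial_mul_pow C ρ h.1 h.2.1 h.2.2) else 0

/-- `kochConst ρ C ≥ 0`. [folklore] -/
theorem kochConst_nonneg (ρ C : ℝ) : 0 ≤ kochConst ρ C := by
  rw [kochConst]
  split_ifs with h
  · exact (Classical.choose_spec (exists_bound_factorial_mul_pow C ρ h.1 h.2.1 h.2.2)).1
  · exact le_rfl

/-- The defining bound of `kochConst`. [folklore] -/
theorem factorial_mul_pow_le_kochConst {ρ C : ℝ} (hC : 0 ≤ C) (hρ : 0 ≤ ρ) (hρ1 : ρ < 1) (m : ℕ) :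
    (m.factorial : ℝ) * C ^ m * ρ ^ (m.choose 2) ≤ kochConst ρ C := by
  rw [kochConst, dif_pos ⟨hC, hρ, hρ1⟩]
  exact (Classical.choose_spec (exists_bound_factorial_mul_pow C ρ hC hρ hρ1)).2 m

/-- **The summable majorant of the von Koch series**: `|det K_S| ≤ B(ρ, C) ρ^{Σ S}`. [folklore] -/
theorem norm_pminor_le_kochConst {ρ C : ℝ} {K : Matrix ℕ ℕ ℂ} (hK : IsCorner ρ C K) (hρ : 0 ≤ ρ)
    (hρ1 : ρ < 1) (S : Finset ℕ) : ‖pminor K S‖ ≤ kochConst ρ C * kochWeight ρ S :=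
  (norm_pminor_le hK hρ hρ1.le S).trans (mul_le_mul_of_nonneg_right
    (factorial_mul_pow_le_kochConst hK.nonneg hρ hρ1 S.card) (kochWeight_nonneg hρ S))

/-- **Absolute convergence of von Koch's series** for a corner-dominated kernel. [folklore] -/
theorem summable_norm_pminor {ρ C : ℝ} {K : Matrix ℕ ℕ ℂ} (hK : IsCorner ρ C K) (hρ : 0 ≤ ρ)
    (hρ1 : ρ < 1) : Summable fun S => ‖pminor K S‖ :=
  Summable.of_nonneg_of_le (fun _ => norm_nonneg _) (norm_pminor_le_kochConst hK hρ hρ1)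
    ((summable_kochWeight hρ hρ1).mul_left _)

/-- Von Koch's series of a corner-dominated kernel is summable. [folklore] -/
theorem summable_pminor {ρ C : ℝ} {K : Matrix ℕ ℕ ℂ} (hK : IsCorner ρ C K) (hρ : 0 ≤ ρ)
    (hρ1 : ρ < 1) : Summable (pminor K) :=
  (summable_norm_pminor hK hρ hρ1).of_norm

/-- The whole determinant is bounded by `B(ρ, C) ∑_S ρ^{Σ S}`. [folklore] -/
theorem norm_detOnePlus_le {ρ C : ℝ} {K : Matrix ℕ ℕ ℂ} (hK : IsCorner ρ C K) (hρ : 0 ≤ ρ)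
    (hρ1 : ρ < 1) : ‖detOnePlus K‖ ≤ kochConst ρ C * ∑' S, kochWeight ρ S := by
  rw [detOnePlus, ← tsum_mul_left]
  exact (norm_tsum_le_tsum_norm (summable_norm_pminor hK hρ hρ1)).trans
    ((summable_norm_pminor hK hρ hρ1).tsum_le_tsum (norm_pminor_le_kochConst hK hρ hρ1)
      ((summable_kochWeight hρ hρ1).mul_left _))

/-! ### Finite sections: `det (1 + P_n K P_n)` is a partial sum of the series -/

/-- **Expansion of `det (M + 1)` in principal minors** (finite matrices): the constant term of the
multilinear expansion, cf. Mathlib's `Matrix.coeff_det_one_add_X_smul_eq_sum_minors`. [folklore] -/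
theorem det_add_one_eq_sum_minors {n : Type*} [Fintype n] [DecidableEq n] (M : Matrix n n ℂ) :
    (M + 1).det = ∑ s : Finset n, (M.submatrix (Subtype.val : s → n) Subtype.val).det := by
  let D := (Matrix.detRowAlternating : (n → ℂ) [⋀^n]→ₗ[ℂ] ℂ)
  have h1 : (M + 1).det = D ((fun i => M i) + fun i => (1 : Matrix n n ℂ) i) := rfl
  rw [h1, D.map_add_univ]
  refine sum_congr rfl fun s _ => ?_
  rw [← Matrix.det_piecewise_one_eq_submatrix_det M s]
  rfl

/-- The index sets of the finite section: `s ⊆ Fin n` corresponds to `S = s.map val ⊆ {0,…,n-1}`,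
with equivalent index types. [folklore] -/
def finsetFinEquiv {n : ℕ} (s : Finset (Fin n)) : (s : Type) ≃ (s.map Fin.valEmbedding : Finset ℕ) where
  toFun x := ⟨(x.1 : ℕ), Finset.mem_map_of_mem _ x.2⟩
  invFun y := ⟨⟨y.1, by
      obtain ⟨a, -, ha⟩ := Finset.mem_map.1 y.2
      rw [← ha]; exact a.isLt⟩, by
      obtain ⟨a, ha, ha'⟩ := Finset.mem_map.1 y.2
      have : a = ⟨y.1, by rw [← ha']; exact a.isLt⟩ := Fin.ext (by simpa using ha')
      rw [← this]; exact ha⟩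
  left_inv x := by ext; rfl
  right_inv y := by ext; rfl

/-- **`det (1 + P_n K P_n) = ∑_{S ⊆ {0,…,n-1}} det K_S`**: the finite-section determinants are the
partial sums of von Koch's series over the subsets of `{0, …, n-1}`. [folklore] -/
theorem det_one_add_finSection (n : ℕ) (K : Matrix ℕ ℕ ℂ) :
    (1 + finSection n K).det = ∑ S ∈ (range n).powerset, pminor K S := by
  rw [add_comm, det_add_one_eq_sum_minors]
  symm
  refine Finset.sum_nbij' (fun S => S.preimage Fin.val Fin.val_injective.injOn)
    (fun s => s.map Fin.valEmbedding) (fun S _ => mem_univ _) (fun s _ => ?_) (fun S hS => ?_)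
    (fun s _ => ?_) (fun S hS => ?_)
  · rw [mem_powerset]
    intro x hx
    obtain ⟨a, -, rfl⟩ := Finset.mem_map.1 hx
    exact mem_range.2 a.isLt
  · rw [mem_powerset] at hS
    ext x
    simp only [Finset.mem_map, Finset.mem_preimage, Fin.valEmbedding_apply]
    constructor
    · rintro ⟨a, ha, rfl⟩; exact ha
    · intro hx
      exact ⟨⟨x, mem_range.1 (hS hx)⟩, hx, rfl⟩
  · ext x
    simp [Finset.mem_preimage, Fin.val_inj]
  · -- the minors agree: reindex by `finsetFinEquiv`
    rw [mem_powerset] at hS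
    set s : Finset (Fin n) := S.preimage Fin.val Fin.val_injective.injOn with hs
    have hmap : s.map Fin.valEmbedding = S := by
      ext x
      simp only [hs, Finset.mem_map, Finset.mem_preimage, Fin.valEmbedding_apply]
      constructor
      · rintro ⟨a, ha, rfl⟩; exact ha
      · intro hx
        exact ⟨⟨x, mem_range.1 (hS hx)⟩, hx, rfl⟩
    have key : ((finSection n K).submatrix (Subtype.val : s → Fin n) Subtype.val).det =
        pminor K (s.map Fin.valEmbedding) := by
      rw [pminor, ← Matrix.det_submatrix_equiv_self (finsetFinEquiv s)]
      rfl
    rw [key, hmap]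

/-- The exhaustion `n ↦ 𝒫({0,…,n-1})` of the finite subsets of `ℕ` is cofinal. [folklore] -/
theorem tendsto_powerset_range : Tendsto (fun n : ℕ => (range n).powerset) atTop atTop := by
  refine Monotone.tendsto_atTop_atTop (fun m n hmn => powerset_mono.2 (range_mono hmn)) fun s => ?_
  refine ⟨(s.sup fun S => S.sup id) + 1, fun S hS => ?_⟩
  rw [mem_powerset]
  intro x hx
  rw [mem_range, Nat.lt_succ_iff]
  exact (Finset.le_sup (f := id) hx).trans (Finset.le_sup (f := fun S => S.sup id) hS)

/-- Partial sums over `𝒫({0,…,n-1})` of a summable family over the finite subsets of `ℕ` converge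
to its sum. [folklore] -/
theorem tendsto_sum_powerset_range {f : Finset ℕ → ℂ} (hf : Summable f) :
    Tendsto (fun n => ∑ S ∈ (range n).powerset, f S) atTop (𝓝 (∑' S, f S)) :=
  hf.hasSum.comp tendsto_powerset_range

/-- Partial sums over `𝒫({0,…,n-1})` of a summable real family converge to its sum. [folklore] -/
theorem tendsto_sum_powerset_range_real {f : Finset ℕ → ℝ} (hf : Summable f) :
    Tendsto (fun n => ∑ S ∈ (range n).powerset, f S) atTop (𝓝 (∑' S, f S)) :=
  hf.hasSum.comp tendsto_powerset_range

/-- **Von Koch's tail** `∑_S ρ^{Σ S} - ∑_{S ⊆ {0,…,n-1}} ρ^{Σ S}` — the modulus of uniform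
convergence of the finite sections. [folklore] -/
def kochTail (ρ : ℝ) (n : ℕ) : ℝ :=
  ∑' S, kochWeight ρ S - ∑ S ∈ (range n).powerset, kochWeight ρ S

/-- `kochTail ρ n → 0`. [folklore] -/
theorem tendsto_kochTail {ρ : ℝ} (hρ : 0 ≤ ρ) (hρ1 : ρ < 1) : Tendsto (kochTail ρ) atTop (𝓝 0) := by
  have h := tendsto_sum_powerset_range_real (summable_kochWeight hρ hρ1)
  have h' := (tendsto_const_nhds (x := ∑' S, kochWeight ρ S)).sub h
  rw [sub_self] at h'
  exact h'

/-- The tail is the sum over the sets not contained in `{0,…,n-1}`. [folklore] -/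
theorem kochTail_eq_tsum_compl {ρ : ℝ} (hρ : 0 ≤ ρ) (hρ1 : ρ < 1) (n : ℕ) :
    kochTail ρ n = ∑' S : ((((range n).powerset : Finset (Finset ℕ)) : Set (Finset ℕ))ᶜ : Set (Finset ℕ)),
      kochWeight ρ S := by
  rw [kochTail, ← (summable_kochWeight hρ hρ1).sum_add_tsum_compl (s := (range n).powerset)]
  ring

/-- `kochTail ρ n ≥ 0`. [folklore] -/
theorem kochTail_nonneg {ρ : ℝ} (hρ : 0 ≤ ρ) (hρ1 : ρ < 1) (n : ℕ) : 0 ≤ kochTail ρ n := by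
  rw [kochTail_eq_tsum_compl hρ hρ1]
  exact tsum_nonneg fun S => kochWeight_nonneg hρ _

/-- **Uniform convergence of the finite sections**: for every kernel with the corner bound
`(ρ, C)`, `|det (1 + K) - det (1 + P_n K P_n)| ≤ B(ρ, C) · kochTail ρ n`, with a right side
independent of `K` and tending to `0`. [folklore] -/
theorem norm_detOnePlus_sub_det_finSection_le {ρ C : ℝ} {K : Matrix ℕ ℕ ℂ} (hK : IsCorner ρ C K)
    (hρ : 0 ≤ ρ) (hρ1 : ρ < 1) (n : ℕ) :
    ‖detOnePlus K - (1 + finSection n K).det‖ ≤ kochConst ρ C * kochTail ρ n := by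
  have hs := summable_pminor hK hρ hρ1
  have hsn := summable_norm_pminor hK hρ hρ1
  rw [det_one_add_finSection, detOnePlus, ← hs.sum_add_tsum_compl (s := (range n).powerset),
    add_sub_cancel_left, kochTail_eq_tsum_compl hρ hρ1, ← tsum_mul_left]
  have hsn' : Summable fun S : ((((range n).powerset : Finset (Finset ℕ)) : Set (Finset ℕ))ᶜ :
      Set (Finset ℕ)) => ‖pminor K S‖ := hsn.subtype _
  refine (norm_tsum_le_tsum_norm hsn').trans ?_
  exact hsn'.tsum_le_tsum (fun S => norm_pminor_le_kochConst hK hρ hρ1 S)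
    (((summable_kochWeight hρ hρ1).mul_left _).subtype _)

/-- **The finite-section determinants converge to von Koch's determinant.** [folklore] -/
theorem tendsto_det_finSection {ρ C : ℝ} {K : Matrix ℕ ℕ ℂ} (hK : IsCorner ρ C K) (hρ : 0 ≤ ρ)
    (hρ1 : ρ < 1) : Tendsto (fun n => (1 + finSection n K).det) atTop (𝓝 (detOnePlus K)) := by
  have h := tendsto_sum_powerset_range (summable_pminor hK hρ hρ1)
  refine h.congr fun n => ?_
  rw [det_one_add_finSection]

/-! ### Dominated convergence -/

/-- **Dominated convergence for von Koch determinants**: if `F x → K` entrywise along a filter and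
the `F x` eventually obey one corner bound `(ρ, C)`, then `det (1 + F x) → det (1 + K)`
(Tannery's theorem for the series of minors, each minor being a polynomial in finitely many
entries). [folklore] -/
theorem tendsto_detOnePlus {ι : Type*} {l : Filter ι} {ρ C : ℝ} {F : ι → Matrix ℕ ℕ ℂ}
    {K : Matrix ℕ ℕ ℂ} (hF : ∀ᶠ x in l, IsCorner ρ C (F x)) (hρ : 0 ≤ ρ) (hρ1 : ρ < 1)
    (h : ∀ i j, Tendsto (fun x => F x i j) l (𝓝 (K i j))) :
    Tendsto (fun x => detOnePlus (F x)) l (𝓝 (detOnePlus K)) := by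
  refine tendsto_tsum_of_dominated_convergence ((summable_kochWeight hρ hρ1).mul_left (kochConst ρ C))
    (fun S => ?_) (hF.mono fun x hx S => norm_pminor_le_kochConst hx hρ hρ1 S)
  -- each minor is continuous in finitely many entries
  have hmat : Tendsto (fun x => (F x).submatrix (Subtype.val : S → ℕ) (Subtype.val : S → ℕ)) l
      (𝓝 (K.submatrix (Subtype.val : S → ℕ) (Subtype.val : S → ℕ))) :=
    tendsto_pi_nhds.2 fun a => tendsto_pi_nhds.2 fun b => h a.1 b.1
  exact ((continuous_id.matrix_det).tendsto _).comp hmat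

/-! ### The second-order expansion `det (1 + K) = 1 + tr K + O(C²)` -/

/-- The sum of the minors of order `≤ 1` is `1 + tr K`. [folklore] -/
theorem tsum_pminor_card_le_one {ρ C : ℝ} {K : Matrix ℕ ℕ ℂ} (hK : IsCorner ρ C K) (hρ : 0 ≤ ρ)
    (hρ1 : ρ < 1) :
    ∑' S, (if S.card ≤ 1 then pminor K S else 0) = 1 + ctrace K := by
  -- split into `S = ∅` and `|S| = 1`
  have h0 : ∀ S : Finset ℕ, (if S.card ≤ 1 then pminor K S else 0) =
      (if S = ∅ then (1 : ℂ) else 0) + (if S.card = 1 then pminor K S else 0) := by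
    intro S
    by_cases hS : S = ∅
    · subst hS; simp
    · have hc : S.card ≠ 0 := fun h => hS (Finset.card_eq_zero.1 h)
      by_cases h1 : S.card = 1
      · simp [h1, hS]
      · have : ¬ S.card ≤ 1 := by omega
        simp [this, hS, h1]
  have hs1 : Summable fun S : Finset ℕ => if S.card = 1 then pminor K S else 0 := by
    refine (summable_norm_pminor hK hρ hρ1).of_norm_bounded (fun S => ?_)
    split_ifs <;> simp
  have hs0 : Summable fun S : Finset ℕ => if S = ∅ then (1 : ℂ) else 0 :=
    summable_of_ne_finset_zero (s := {∅}) (by intro S hS; simp at hS; simp [hS])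
  rw [tsum_congr h0, hs0.tsum_add hs1, tsum_ite_eq]
  congr 1
  -- the order-one minors: reindex by `i ↦ {i}`
  rw [ctrace, ← Function.Injective.tsum_eq (g := fun i : ℕ => ({i} : Finset ℕ))
    Finset.singleton_injective]
  · exact tsum_congr fun i => by simp
  · intro S hS
    rw [Function.mem_support] at hS
    have h1 : S.card = 1 := by
      by_contra h; exact hS (if_neg h)
    obtain ⟨i, rfl⟩ := Finset.card_eq_one.1 h1
    exact ⟨i, rfl⟩

/-- **`det (1 + K) = 1 + tr K + O(C²)`**: for a kernel with corner bound `(ρ, C)`, `C ≤ 1`, the minors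
of order `≥ 2` contribute at most `B(ρ, 1) (∑_S ρ^{Σ S}) C²`. [folklore] -/
theorem norm_detOnePlus_sub_one_sub_ctrace_le {ρ C : ℝ} {K : Matrix ℕ ℕ ℂ} (hK : IsCorner ρ C K)
    (hρ : 0 ≤ ρ) (hρ1 : ρ < 1) (hC1 : C ≤ 1) :
    ‖detOnePlus K - 1 - ctrace K‖ ≤ kochConst ρ 1 * (∑' S, kochWeight ρ S) * C ^ 2 := by
  have hC0 : 0 ≤ C := hK.nonneg
  set g : Finset ℕ → ℂ := fun S => if S.card ≤ 1 then pminor K S else 0 with hg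
  set h : Finset ℕ → ℂ := fun S => if S.card ≤ 1 then 0 else pminor K S with hh
  have hsplit : pminor K = g + h := by
    funext S; simp only [hg, hh, Pi.add_apply]; split_ifs <;> simp
  have hgs : Summable g := by
    refine (summable_norm_pminor hK hρ hρ1).of_norm_bounded (fun S => ?_)
    simp only [hg]; split_ifs <;> simp
  -- the bound on the order `≥ 2` minors
  have hbound : ∀ S, ‖h S‖ ≤ kochConst ρ 1 * C ^ 2 * kochWeight ρ S := by
    intro S
    simp only [hh]
    split_ifs with hS
    · simpa using mul_nonneg (mul_nonneg (kochConst_nonneg ρ 1) (sq_nonneg C))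
        (kochWeight_nonneg hρ S)
    · have h2 : 2 ≤ S.card := by omega
      refine (norm_pminor_le hK hρ hρ1.le S).trans ?_
      have hCpow : C ^ S.card ≤ C ^ 2 := pow_le_pow_of_le_one hC0 hC1 h2
      have hB := factorial_mul_pow_le_kochConst zero_le_one hρ hρ1 S.card
      rw [one_pow, mul_one] at hB
      calc (S.card.factorial : ℝ) * C ^ S.card * ρ ^ (S.card.choose 2) * kochWeight ρ S
          = (S.card.factorial * ρ ^ (S.card.choose 2)) * C ^ S.card * kochWeight ρ S := by ring
        _ ≤ kochConst ρ 1 * C ^ 2 * kochWeight ρ S := by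
          refine mul_le_mul_of_nonneg_right ?_ (kochWeight_nonneg hρ S)
          exact mul_le_mul hB hCpow (pow_nonneg hC0 _) (kochConst_nonneg ρ 1)
  have hhs : Summable h :=
    Summable.of_norm_bounded ((summable_kochWeight hρ hρ1).mul_left _) hbound
  rw [detOnePlus, hsplit]
  simp only [Pi.add_apply]
  rw [hgs.tsum_add hhs, hg, tsum_pminor_card_le_one hK hρ hρ1]
  have : 1 + ctrace K + ∑' S, h S - 1 - ctrace K = ∑' S, h S := by ring
  rw [this]
  calc ‖∑' S, h S‖ ≤ ∑' S, ‖h S‖ := norm_tsum_le_tsum_norm hhs.norm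
    _ ≤ ∑' S, kochConst ρ 1 * C ^ 2 * kochWeight ρ S :=
        hhs.norm.tsum_le_tsum hbound ((summable_kochWeight hρ hρ1).mul_left _)
    _ = kochConst ρ 1 * (∑' S, kochWeight ρ S) * C ^ 2 := by rw [tsum_mul_left]; ring

/-- The trace of a corner kernel is small with the constant: `|tr K| ≤ C / (1 - ρ²)`. [folklore] -/
theorem norm_ctrace_le {ρ C : ℝ} {K : Matrix ℕ ℕ ℂ} (hK : IsCorner ρ C K) (hρ : 0 ≤ ρ)
    (hρ1 : ρ < 1) : ‖ctrace K‖ ≤ C / (1 - ρ ^ 2) := by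
  have hρ2 : ρ ^ 2 < 1 := pow_lt_one₀ hρ hρ1 two_ne_zero
  have hgeo := summable_geometric_of_lt_one (pow_nonneg hρ 2) hρ2
  have hle : ∀ i, ‖K i i‖ ≤ C * (ρ ^ 2) ^ i := fun i => by
    calc ‖K i i‖ ≤ C * ρ ^ (i + i) := hK i i
      _ = C * (ρ ^ 2) ^ i := by rw [← two_mul, pow_mul]
  rw [ctrace]
  calc ‖∑' i, K i i‖ ≤ ∑' i, ‖K i i‖ := norm_tsum_le_tsum_norm (hK.summable_norm_diag hρ hρ1)
    _ ≤ ∑' i, C * (ρ ^ 2) ^ i := (hK.summable_norm_diag hρ hρ1).tsum_le_tsum hle (hgeo.mul_left _)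
    _ = C / (1 - ρ ^ 2) := by
        rw [tsum_mul_left, tsum_geometric_of_lt_one (pow_nonneg hρ 2) hρ2, div_eq_mul_inv]

/-! ### Multiplicativity -/

/-- **Multiplicativity of von Koch determinants**: `det ((1 + K)(1 + L)) = det (1 + K) det (1 + L)`
for corner-dominated `K, L`, i.e. `detOnePlus (K + L + K L) = detOnePlus K * detOnePlus L`
(finite multiplicativity on the sections `P_n`, the uniform section estimate, and dominated
convergence along `K + L + K P_n L → K + L + K L`). [folklore] -/
theorem detOnePlus_add_mul {ρ C D : ℝ} {K L : Matrix ℕ ℕ ℂ} (hK : IsCorner ρ C K)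
    (hL : IsCorner ρ D L) (hρ : 0 ≤ ρ) (hρ1 : ρ < 1) :
    detOnePlus (K + L + imul K L) = detOnePlus K * detOnePlus L := by
  -- the approximants `M n = K + L + K P_n L`
  set M : ℕ → Matrix ℕ ℕ ℂ := fun n => K + L + imulTrunc n K L with hM
  have hMc : ∀ n, IsCorner ρ (C + D + C * D / (1 - ρ ^ 2)) (M n) := fun n =>
    (hK.add hL).add (hK.imulTrunc hL hρ hρ1 n)
  -- (1) finite multiplicativity on the sections
  have hfin : ∀ n, (1 + finSection n (M n)).det =
      (1 + finSection n K).det * (1 + finSection n L).det := by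
    intro n
    rw [← Matrix.det_mul]
    congr 1
    simp only [hM, finSection_add, finSection_imulTrunc, Matrix.mul_add, Matrix.add_mul,
      Matrix.one_mul, Matrix.mul_one]
    abel
  -- (2) the right side converges to the product of the determinants
  have h2 : Tendsto (fun n => (1 + finSection n (M n)).det) atTop
      (𝓝 (detOnePlus K * detOnePlus L)) := by
    simp_rw [hfin]
    exact (tendsto_det_finSection hK hρ hρ1).mul (tendsto_det_finSection hL hρ hρ1)
  -- (3) the sections of `M n` are uniformly close to `detOnePlus (M n)`
  have h3 : Tendsto (fun n => detOnePlus (M n) - (1 + finSection n (M n)).det) atTop (𝓝 0) := by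
    rw [tendsto_zero_iff_norm_tendsto_zero]
    refine squeeze_zero (fun n => norm_nonneg _)
      (fun n => norm_detOnePlus_sub_det_finSection_le (hMc n) hρ hρ1 n) ?_
    have := (tendsto_kochTail hρ hρ1).const_mul (kochConst ρ (C + D + C * D / (1 - ρ ^ 2)))
    rwa [mul_zero] at this
  -- (4) dominated convergence `detOnePlus (M n) → detOnePlus (K + L + K L)`
  have h4 : Tendsto (fun n => detOnePlus (M n)) atTop (𝓝 (detOnePlus (K + L + imul K L))) := by
    refine tendsto_detOnePlus (Eventually.of_forall hMc) hρ hρ1 fun i j => ?_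
    simp only [hM, Matrix.add_apply]
    exact tendsto_const_nhds.add (hK.tendsto_imulTrunc hL hρ hρ1 i j)
  -- (5) conclude
  have h5 : Tendsto (fun n => detOnePlus (M n)) atTop (𝓝 (0 + detOnePlus K * detOnePlus L)) := by
    have := h3.add h2
    refine this.congr fun n => ?_
    ring
  rw [zero_add] at h5
  exact tendsto_nhds_unique h4 h5

/-! ### Sylvester's identity -/

/-- **Sylvester's identity for von Koch determinants**: `det (1 + A K) = det (1 + K A)` for a
corner-dominated `K` and a row- and column-dominated `A` (Mathlib's finite
`Matrix.det_one_add_mul_comm` for the blocks `A|_{N × M}`, `K|_{M × N}`, then `M → ∞` and `N → ∞` by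
the section estimate and dominated convergence). In particular von Koch determinants are invariant
under conjugation by invertible dominated matrices. [folklore] -/
theorem detOnePlus_imul_comm {ρ C α : ℝ} {K A : Matrix ℕ ℕ ℂ} (hK : IsCorner ρ C K)
    (hAr : IsRowDom ρ α A) (hAc : IsColDom ρ α A) (hρ : 0 ≤ ρ) (hρ1 : ρ < 1) :
    detOnePlus (imul A K) = detOnePlus (imul K A) := by
  -- Step 1: for every `N`, `det (1 + P_N (A K) P_N) = detOnePlus (K P_N A)`
  have step : ∀ N : ℕ, (1 + finSection N (imul A K)).det = detOnePlus (imulTrunc N K A) := by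
    intro N
    -- the finite Sylvester identity for the blocks
    have hfinite : ∀ M : ℕ, (1 + finSection N (imulTrunc M A K)).det =
        (1 + finSection M (imulTrunc N K A)).det := by
      intro M
      set X : Matrix (Fin N) (Fin M) ℂ := Matrix.of fun i m => A i m with hX
      set Y : Matrix (Fin M) (Fin N) ℂ := Matrix.of fun m j => K m j with hY
      have hXY : X * Y = finSection N (imulTrunc M A K) := by
        ext i j
        simp only [Matrix.mul_apply, hX, hY, Matrix.of_apply, finSection_apply, imulTrunc_apply]
        exact Fin.sum_univ_eq_sum_range (fun m => A i m * K m j) M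
      have hYX : Y * X = finSection M (imulTrunc N K A) := by
        ext m m'
        simp only [Matrix.mul_apply, hX, hY, Matrix.of_apply, finSection_apply, imulTrunc_apply]
        exact Fin.sum_univ_eq_sum_range (fun i => K m i * A i m') N
      rw [← hXY, ← hYX]
      exact Matrix.det_one_add_mul_comm X Y
    -- `M → ∞` on the left: finitely many entries converge
    have hleft : Tendsto (fun M => (1 + finSection N (imulTrunc M A K)).det) atTop
        (𝓝 ((1 + finSection N (imul A K)).det)) := by
      have hmat : Tendsto (fun M => finSection N (imulTrunc M A K)) atTop
          (𝓝 (finSection N (imul A K))) :=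
        tendsto_pi_nhds.2 fun i => tendsto_pi_nhds.2 fun j =>
          tendsto_imulTrunc (hAr.summable_norm_mul_corner hK i j).of_norm
      exact ((continuous_const.add continuous_id).matrix_det.tendsto _).comp hmat
    -- `M → ∞` on the right: sections of the fixed corner kernel `K P_N A`
    have hright : Tendsto (fun M => (1 + finSection M (imulTrunc N K A)).det) atTop
        (𝓝 (detOnePlus (imulTrunc N K A))) :=
      tendsto_det_finSection (hK.imulTrunc_colDom hAc hρ N) hρ hρ1
    have := tendsto_nhds_unique hleft (hright.congr fun M => (hfinite M).symm)
    exact this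
  -- Step 2: `N → ∞`
  have hleft : Tendsto (fun N => (1 + finSection N (imul A K)).det) atTop
      (𝓝 (detOnePlus (imul A K))) :=
    tendsto_det_finSection (hAr.imul_corner hK hρ) hρ hρ1
  have hright : Tendsto (fun N => detOnePlus (imulTrunc N K A)) atTop
      (𝓝 (detOnePlus (imul K A))) :=
    tendsto_detOnePlus (Eventually.of_forall fun N => hK.imulTrunc_colDom hAc hρ N) hρ hρ1
      fun i j => tendsto_imulTrunc (hK.summable_norm_mul_colDom hAc i j).of_norm
  exact tendsto_nhds_unique (hleft.congr step) hright

end Literature.Analysis.Toeplitz
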